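import Summits.NavierStokesRegularity.FunctionalMining.CrossedShearPressure
import Summits.NavierStokesRegularity.FunctionalMining.PidevMomentRate
import HarnessLib

/-!
# FunctionalMining — kernel no-go: the deviatoric pressure-Hessian row `EP.Pidev.q=2|T_LD|G1` is FALSE ∀κ (W11)

Search for candidate a priori estimates; no regularity claim. Cell `pub-nsfunc`, prove seat
(gen 10). SIEVELD §2, Corollary W11 for the core `∫|Π^dev|²`: at the reciprocal crossed shear `u_β`
(`σ = −s_{u_β} = −8π² cc`, `A = −8π² h_β(x₂) cc`, `CrossedShearPressure`) the viscous rate of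
`∫|Π^dev|²` (`pidevSqViscousRate v = 2(1−1/n)(∫σA − (∫σ)(∫A))`, `PidevMomentRate`, `n = 3`) is
`V(u_β) = (4/3)·64π⁴∫h_β cc² = (256/3)π⁶(β² − 2)`; at `β = 2` it is positive, so Theorem H
(`HeatSieve`) kills `SaturatingLaw (∫|Π^dev|²) σ γ κ` for every `κ`, `σ`, `γ ≥ 0` — in particular the
K0 row `EP.Pidev.q=2|T_LD|G1`, whose own exponents are `(σ_F, γ_F) = (5, 9/5)` (K0 v1.6; dimensionally
`∫|∇²p|² ∼ L³T⁻⁴`, the pair of `∫|ω|⁴`; referee F56.3): the general theorem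
`not_saturatingLaw_pidevMoment_two` instantiated at `(5, 9/5)`, literal decl
`CrossedShear.not_saturatingLaw_pidevMoment_two_row'` in `CrossedShearPidevRpow`. The instance
`not_saturatingLaw_pidevMoment_two_row` below, at `(3, 7/3)` (the `∇π`-row pair), is true but is NOT the
K0 row (gen-10 labelling slip, corrected gen 11). Explicit-witness no-go; nothing about regularity.
-/

noncomputable section

open MeasureTheory Set Filter Topology Real
open scoped InnerProductSpace ContDiff

namespace Summit.NavierStokesRegularity.FunctionalMining

open Literature.Analysis Literature.Analysis.FunctionSpaces Literature.Analysis.FunctionSpaces.Torus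
open Literature.Analysis.FluidPDE

namespace CrossedShear

/-- **`V(u_β) = (256/3)π⁶(β² − 2)`** for the deviatoric pressure-Hessian moment at the crossed shear.
[ours] -/
theorem pidevSqViscousRate_cshear (β : ℝ) :
    pidevSqViscousRate (cshear β) = 256 / 3 * π ^ 6 * (β ^ 2 - 2) := by
  unfold pidevSqViscousRate
  simp only [gradSqTrace_cshear, pressureSqViscousSource_cshear, Fintype.card_fin]
  have e : ∀ x : UnitAddTorus (Fin 3), -(8 * π ^ 2 * cc x) * (-(8 * π ^ 2) * (heatProfile β (x 2) * cc x)) =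
      64 * π ^ 4 * (heatProfile β (x 2) * cc x ^ 2) := by
    intro x; ring
  have e0 : ∀ x : UnitAddTorus (Fin 3), -(8 * π ^ 2 * cc x) = -(8 * π ^ 2) * cc x := by intro x; ring
  simp_rw [e]
  simp_rw [e0]
  rw [integral_const_mul, integral_const_mul, integral_mul_cc_sq, integral_circle_heatProfile, integral_cc]
  push_cast
  ring

/-- **Kernel no-go (SIEVELD §1–§2): `∫|Π^dev|²` obeys NO saturating law.** For every `κ`, every `σ`
and every `γ ≥ 0`, `SaturatingLaw (torusPidevMoment 2) σ γ κ` fails on `T³` (crossed shear `u₂`: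
viscous initial rate `(512/3)π⁶ > 0`, Theorem H). In particular the K0 row `EP.Pidev.q=2|T_LD|G1`
(`σ_F = 5`, `γ_F = 9/5`; instantiate with `(by norm_num : (0:ℝ) ≤ 9/5)`) is FALSE for every κ. Search
for candidate a priori estimates; no regularity claim. [ours; SIEVELD §1 Thm H, §2 Cor. W11] -/
theorem not_saturatingLaw_pidevMoment_two {σ γ : ℝ} (hγ : 0 ≤ γ) (κ : ℝ) :
    ¬ SaturatingLaw (d := Fin 3) (torusPidevMoment 2) σ γ κ := by
  have hV : 0 < pidevSqViscousRate (cshear 2) := by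
    rw [pidevSqViscousRate_cshear]
    have : (0 : ℝ) < π ^ 6 := by positivity
    nlinarith
  exact not_saturatingLaw_of_viscousRate_pos hasInitialRate_torusPidevMoment_two (by simp)
    (isSmooth_cshear 2) (isDivFree_cshear 2) (hasZeroMean_cshear 2) hV hγ κ

/-- The instance of `not_saturatingLaw_pidevMoment_two` at `(σ, γ) = (3, 7/3)` — NOT the K0 row
`EP.Pidev.q=2|T_LD|G1` (whose exponents are `(5, 9/5)`: see `CrossedShear.not_saturatingLaw_pidevMoment_two_row'`
in `CrossedShearPidevRpow`; the name is kept for ledger stability, referee F56.3). [ours] -/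
theorem not_saturatingLaw_pidevMoment_two_row (κ : ℝ) :
    ¬ SaturatingLaw (d := Fin 3) (torusPidevMoment 2) 3 (7 / 3) κ :=
  not_saturatingLaw_pidevMoment_two (by norm_num) κ

end CrossedShear

end Summit.NavierStokesRegularity.FunctionalMining
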